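import Summits.BirchSwinnertonDyer.Rank1Residual.Additive.GordRamifiedOrdinaryLine
import Summits.BirchSwinnertonDyer.Rank1Residual.Additive.CyclotomicCharacterOnStableLine
import Summits.BirchSwinnertonDyer.Rank1Residual.Additive.MixedCongruenceTameness
import Summits.BirchSwinnertonDyer.Rank1Residual.Additive.DictionaryUniform
import Summits.BirchSwinnertonDyer.Rank1Residual.AdditivePotMult.PStarTwistModel
import Summits.BirchSwinnertonDyer.Rank1Residual.GaloisImage.SmallImageInertiaOrderCyclotomic
import Summits.BirchSwinnertonDyer.Rank1Residual.GaloisImage.SmallImageSemisimpleInertia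
import Literature.NumberTheory.GaloisRepresentations.KummerQuadraticCharacterInertia
import Literature.NumberTheory.EllipticCurves.QuadraticBaseChangeGaloisProofs
import Literature.NumberTheory.EllipticCurves.Rank1Residual.GVParityTransferProofs
import Literature.NumberTheory.GaloisRepresentations.IntegralGaloisActionProofs
import Literature.NumberTheory.EllipticCurves.TateCurve.NumberFieldUniformizationTwisted
import Literature.NumberTheory.EllipticCurves.TateCurve.NumberFieldUniformization
import Literature.NumberTheory.GaloisRepresentations.RatPlaceTwoProofs
import Summits.BirchSwinnertonDyer.Rank1Residual.X2.IsogenyLineType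
import Summits.BirchSwinnertonDyer.Rank1Residual.Additive.SharpenedStatements
import HarnessLib

/-!
# Route `SchneiderFreeAdditiveX3` (K1 door): the NON-ANOMALOUS CLAUSE at an additive prime `p ≥ 5` of a
# SEMISTABLE-TWIST curve — for `E = V ⊗ χ_{p*}` (`V` good ordinary or multiplicative at `p`) no decomposition
# group above `p` fixes a rational line of `E[p]` pointwise or acts trivially on its quotient

Cell `bsd-schneider-ideate`, seat `bsd-schneider-door-c5` (prover, generation 23; assembly layer; `--supports` 19177).
PARTITION: board row B6 ∩ X3 ∩ sst-twist, `r = 1` (7 101 pairs; (G-ord, `e = 2`) half 2 560, (M) half 4 541), at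
`p ≥ 5`; types-the-object-of nothing new; supplies the LOCAL input under which the `μ`-clause [INV.μ] and the
`Λ`-torsion clause of Keller–Yin Thm. 3.5.1 follow from the PUBLISHED Castella–Grossi–Lee–Skinner 2022 Prop. 14 (companion
file `…KYMuZeroOfPrintFiveLe`); closes none of B6's cells (BSD NOT advanced).
bears_on: K1-door (items 18971/18972 → 19177 r3) + K1-wing (20365 r3).

WHAT.  CGLS 2022 Prop. 14 (Rubin 1991 + Hida 2010) gives the finiteness of the residual Selmer group of a character
`θ` of `K` under the local hypothesis `θ|_{G_{v̄}} ∉ {1, ω}`.  For the K1 door's curves — `E/ℚ` additive at `p` with a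
SEMISTABLE quadratic twist `V = E^{(p*)}` (good ORDINARY or MULTIPLICATIVE at `p`) and `E[p]` reducible — the two
Jordan–Hölder characters of `E[p]|_{I_p}` are `ω·ε` and `ε` up to order, `ε|_{I_p} = ω^{(p−1)/2}` the ramified quadratic
character, i.e. `ω^{(p+1)/2}` and `ω^{(p−1)/2}`: for `p ≥ 5` NEITHER is trivial (nor `ω`).  This file proves the
consequence the dévissage consumes, in the tree's residual vocabulary (`X2.TateLineDecomposition` /
`KellerYinLemma511NonsplitOfPrint` §1 shape): for every prime `𝔓` of `\bar ℤ` above `p` and every rational line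
`Φ ≤ E[p]`, the decomposition group `D_𝔓 ≤ Γ_ℚ` does NOT fix `Φ` pointwise and does NOT act trivially on `E[p]/Φ`.

PROOF (no Gauss sum, no `ε = ω^{(p−1)/2}`): transport `Φ` along the sign-equivariant twisting isomorphism
`e : E[p] ≃ V[p]` (`e(σT) = ±σ e(T)` according as `σ√p* = ±√p*`, Silverman X.5.4, tree `exists_signEquiv_of_twist`);
let `L ≤ V[p]` be the unramified-quotient line at `I_𝔓` (`(σ − 1)V[p] ⊆ L`, on which `σ ∈ I_𝔓` acts by `χ̄_p(σ)` —
Serre §1.11, tree `smul_eq_cyclotomic_zsmul_of_forall_sub_mem`); pick `τ ∈ I_𝔓` with `χ̄_p(τ)` a generator of `𝔽_p^×`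
(`χ̄_p(I_𝔓) = 𝔽_p^×`) and a Kummer element `σ₁ ∈ I_𝔓` with `σ₁√p* = −√p*` (`ord_p(p*) = 1`).  Then `τ²` fixes `√p*`
and `χ̄_p(τ²) = u² ≠ 1` (`p − 1 ∤ 2` as `p ≥ 5`).  If `e(Φ) = L`: `τ²` acts on `L` by `u² ≠ 1`, so it neither fixes `Φ`
nor (if `D_𝔓` were trivial on `E[p]/Φ`) acts trivially on `V[p]` — contradiction either way.  If `e(Φ) ≠ L`: inertia
acts trivially on `e(Φ)` (`(σ−1)e(Φ) ⊆ L ∩ e(Φ) = 0`), so `σ₁` acts on `Φ` by `−1 ≠ 1`; and if `D_𝔓` were trivial on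
`E[p]/Φ`, then `−σ₁T − T ∈ L` and `σ₁T − T ∈ L` for all `T`, so `2T ∈ L`, `V[p] ⊆ L` — contradiction.

* §1 `not_fix_and_not_quot_of_twist_of_unramifiedQuotientLine` — the local lemma (any `d ∈ ℤ` with `ord_p d = 1`, any `V` with
  an unramified-quotient line at `I_𝔓`, `p ≥ 5`); §2 class forms `…_of_goodOrd_pStar_twist` (Serre's line, every `𝔓 ∣ p`),
  `…_of_classX3_of_subGordTwo` ((G-ord, `e = 2`) via `ClassX3Gord.exists_goodOrd_pStar_twist_model`), `…_of_mult_pStar_twist` /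
  `…_of_classX3_of_subM` ((M): X2's Tate line, PROVED Tate uniformisation, conjugation to every `𝔓`), `…_of_subSemistableTwist`.

HONEST FRAMING: theorems only (finite group theory on the `𝔽_p`-plane `E[p]` over tree theorems); no definition, no named
fact, no `sorry`; nothing about BSD or a main conjecture is asserted; at `p = 3` the clause FAILS in general (`ε|_{I_3} = ω`,
characters `{ω², ω} = {1, ω}`) and nothing is claimed there; «closes rung: none».  References: Serre, Invent. Math. 15 (1972)
§1.11–1.12 [Serre1972]; Silverman *AEC* X.5 Cor. 5.4 [SilvermanAEC2009], *ATAEC* V.5.3–5.4 [SilvermanATAEC1994]; Greenberg–Vatsal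
2000 §2 [GreenbergVatsal2000]; CGLS 2022 Prop. 14 [CastellaGrossiLeeSkinner2022]; Lang *FDG* Ch. 6 Prop. 1.3 [Lang1983]; bsd-eis p626493.
-/

set_option autoImplicit false
set_option linter.dupNamespace false -- the summit namespace `…BirchSwinnertonDyer.BirchSwinnertonDyer.Theorems` (Sub = Summit, D-0017) trips it

noncomputable section

open scoped Classical NumberField Pointwise

open WeierstrassCurve NumberField IsDedekindDomain Field
  Literature.NumberTheory.EllipticCurves Literature.NumberTheory.GaloisRepresentations
  Literature.NumberTheory.EllipticCurves.Rank1Residual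
  Summit.BirchSwinnertonDyer.Rank1Residual Summit.BirchSwinnertonDyer.Rank1Residual.GaloisImage
  Summit.BirchSwinnertonDyer.Rank1Residual.Additive Summit.BirchSwinnertonDyer.Rank1Residual.AdditivePotMult

namespace Summit.BirchSwinnertonDyer.BirchSwinnertonDyer.Theorems.SchneiderFreeAdditiveX3.SemistableTwistLocal

/-! ### §0 Two elementary facts on the `𝔽_p`-plane `E[p]` -/

section Plane

variable {W : WeierstrassCurve ℚ} {p : ℕ} [hp : Fact p.Prime]

/-- If an integer `a` acts as the identity on a non-zero `p`-torsion point, then `a ≡ 1 (mod p)`. [folklore] -/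
theorem intCast_eq_one_of_zsmul_eq_self {x : geomTorsion W (p : ℤ)} (hx : x ≠ 0) {a : ℤ} (h : a • x = x) :
    ((a : ℤ) : ZMod p) = 1 := by
  have hord : addOrderOf x = p :=
    addOrderOf_eq_prime (by rw [← natCast_zsmul]; exact natCast_zsmul_eq_zero x) hx
  have h0 : (a - 1) • x = 0 := by rw [sub_smul, one_smul, h, sub_self]
  have hdvd : (p : ℤ) ∣ a - 1 := by
    rw [← hord]
    exact (addOrderOf_dvd_iff_zsmul_eq_zero).mpr h0
  have h1 : (((a - 1 : ℤ)) : ZMod p) = 0 := (ZMod.intCast_zmod_eq_zero_iff_dvd _ p).mpr hdvd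
  rwa [Int.cast_sub, Int.cast_one, sub_eq_zero] at h1

/-- For `p` odd, a subgroup of `E[p]` containing `2 • T` contains `T` (`T = ((p+1)/2) • (2 • T)`). [folklore] -/
theorem mem_of_two_zsmul_mem (hp2 : p ≠ 2) {L : AddSubgroup (geomTorsion W (p : ℤ))}
    {T : geomTorsion W (p : ℤ)} (h : (2 : ℤ) • T ∈ L) : T ∈ L := by
  obtain ⟨k, hk⟩ : ∃ k : ℕ, p + 1 = 2 * k := by
    obtain ⟨m, hm⟩ := hp.out.odd_of_ne_two hp2
    exact ⟨m + 1, by omega⟩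
  have hT : ((k : ℤ) * 2) • T = T := by
    have h1 : ((k : ℤ) * 2) = (p : ℤ) + 1 := by omega
    rw [h1, add_smul, one_smul, natCast_zsmul_eq_zero, zero_add]
  rw [← hT, mul_smul]
  exact L.zsmul_mem h k

/-- For `p` odd, `-x = x` forces `x = 0` on `E[p]`. [folklore] -/
theorem eq_zero_of_neg_eq_self (hp2 : p ≠ 2) {x : geomTorsion W (p : ℤ)} (h : -x = x) : x = 0 := by
  by_contra hx
  have hord : addOrderOf x = p :=
    addOrderOf_eq_prime (by rw [← natCast_zsmul]; exact natCast_zsmul_eq_zero x) hx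
  have h2 : (2 : ℤ) • x = 0 := by rw [two_zsmul]; nth_rw 1 [← h]; exact neg_add_cancel x
  have hdvd : (p : ℤ) ∣ 2 := by
    rw [← hord]
    exact (addOrderOf_dvd_iff_zsmul_eq_zero).mpr h2
  have hle : p ≤ 2 := Nat.le_of_dvd two_pos (by exact_mod_cast hdvd)
  have h2le := hp.out.two_le
  omega

end Plane

/-! ### §1 The local lemma: a twist by a `p`-uniformizer of a curve with an unramified-quotient line, `p ≥ 5` -/

section Local

variable {V W : WeierstrassCurve ℚ} [V.IsElliptic] {p : ℕ} [hp : Fact p.Prime]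

/-- **The non-anomalous clause at an additive prime `p ≥ 5` of a semistable-twist curve.**  Let `W = C • V^{(d)}` be a
`ℚ`-model of the quadratic twist of `V` by an integer `d` with `ord_p d = 1` (e.g. `d = p*`), `p ≥ 5`, `𝔓` a prime of
`\bar ℤ` above `p`, and suppose `V[p]` has an UNRAMIFIED-QUOTIENT LINE at `I_𝔓` (a line `L` with `(σ − 1)V[p] ⊆ L` for
`σ ∈ I_𝔓`: `V` good ordinary — Serre's line — or multiplicative — the Tate line — at `p`).  Then for every rational line
`Φ ≤ W[p]` the decomposition group `D_𝔓 ≤ Γ_ℚ` does NOT fix `Φ` pointwise and does NOT act trivially on `W[p]/Φ`.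
(Jordan–Hölder characters of `W[p]|_{I_𝔓}`: `ω^{(p+1)/2}`, `ω^{(p−1)/2}`, both `∉ {1, ω}` for `p ≥ 5`.)  Proof in the
module docstring: sign-equivariant twisting isomorphism, `χ̄_p(I_𝔓) = 𝔽_p^×` (an element `τ` with `χ̄_p(τ)` of order
`p − 1`, so `χ̄_p(τ²) ≠ 1` as `p ≥ 5`, and `τ²` fixes `√d`), a Kummer inertia element `σ₁√d = −√d`, and the scalar
`χ̄_p(σ)` by which inertia acts on the unramified-quotient line.  Pure finite group theory over tree theorems.
[cite: Serre1972, §1.11 Prop. 11 and §1.12 Prop. 13] [cite: SilvermanAEC2009, X.5 Cor. 5.4]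
[cite: GreenbergVatsal2000, §2 pp. 14–15] [cite: Lang1983, Ch. 6 Prop. 1.3] -/
theorem not_fix_and_not_quot_of_twist_of_unramifiedQuotientLine (hp5 : 5 ≤ p)
    {d : ℤ} (C : VariableChange ℚ) (hC : C • V.quadraticTwist (d : ℚ) = W)
    {v : HeightOneSpectrum (𝓞 ℚ)} (hpv : ((p : ℕ) : 𝓞 ℚ) ∈ v.asIdeal)
    (hd : v.intValuation (d : 𝓞 ℚ) = WithZero.exp (-1 : ℤ))
    {𝔓 : Ideal (absIntegers (𝓞 ℚ) ℚ)} (h𝔓 : 𝔓 ∈ v.primesAbove)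
    (hUQ : MixedCongruence.UnramifiedQuotientLineAt V p (𝔓.inertia (absoluteGaloisGroup ℚ)))
    {Φ : AddSubgroup (geomTorsion W (p : ℤ))} (hΦ : IsRationalLine W p Φ) :
    (¬ ∀ g ∈ 𝔓.decompositionSubgroup (absoluteGaloisGroup ℚ), ∀ P ∈ Φ, g • P = P) ∧
      (¬ ∀ g ∈ 𝔓.decompositionSubgroup (absoluteGaloisGroup ℚ),
        ∀ P : geomTorsion W (p : ℤ), g • P - P ∈ Φ) := by
  have hpP : p.Prime := hp.out
  have hp2 : p ≠ 2 := by omega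
  have hd0 : (d : ℚ) ≠ 0 := by
    rintro h
    have hdz : d = 0 := by exact_mod_cast h
    rw [hdz, Int.cast_zero, map_zero] at hd
    exact WithZero.zero_ne_coe hd
  have hID : 𝔓.inertia (absoluteGaloisGroup ℚ) ≤ 𝔓.decompositionSubgroup (absoluteGaloisGroup ℚ) :=
    Ideal.inertia_le_decompositionSubgroup _ _
  -- the unramified-quotient line of `V[p]` at `I_𝔓`
  obtain ⟨L, hL, hLsub⟩ := hUQ
  -- the sign-equivariant twisting isomorphism `e : W[p] ≃ V[p]`
  have hC' : C⁻¹ • W = V.quadraticTwist (d : ℚ) := by rw [← hC, inv_smul_smul]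
  obtain ⟨e, hpos, hneg⟩ := exists_signEquiv_of_twist (W := V) (Wd := W) (p := p) hd0 C⁻¹ hC'
  -- the transported line `ΦV = e(Φ) ≤ V[p]`
  set ΦV : AddSubgroup (geomTorsion V (p : ℤ)) := Φ.map e.toAddMonoidHom with hΦV
  have hmem : ∀ P, e P ∈ ΦV ↔ P ∈ Φ := fun P ↦ by
    rw [hΦV, AddSubgroup.mem_map_equiv, AddEquiv.symm_apply_apply]
  have hΦVcard : Nat.card ΦV = p :=
    (Nat.card_congr (Φ.equivMapOfInjective e.toAddMonoidHom e.injective).toEquiv).symm.trans hΦ.1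
  have hstab : ∀ (σ : absoluteGaloisGroup ℚ), ∀ T ∈ ΦV, σ • T ∈ ΦV := by
    intro σ T hT
    obtain ⟨P, rfl⟩ : ∃ P, e P = T := ⟨e.symm T, e.apply_symm_apply T⟩
    have hP : P ∈ Φ := (hmem P).mp hT
    by_cases hs : σ • geomSqrt (d : ℚ) = geomSqrt (d : ℚ)
    · rw [← hpos σ hs, hmem]
      exact hΦ.2 σ P hP
    · have h1 : σ • e P = -e (σ • P) := by rw [hneg σ hs, neg_neg]
      rw [h1, ← map_neg, hmem]
      exact Φ.neg_mem (hΦ.2 σ P hP)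
  -- a Kummer inertia element moving `√d`
  have h2v : (2 : 𝓞 ℚ) ∉ v.asIdeal := two_not_mem_of_natCast_prime_mem hpP hp2 hpv
  obtain ⟨σ₁, hσ₁I, hσ₁⟩ := exists_mem_inertia_smul_geomSqrt_eq_neg (E := ℚ) hd h2v h𝔓
  have hcoe : (((d : 𝓞 ℚ)) : ℚ) = (d : ℚ) := by rw [RingOfIntegers.coe_eq_algebraMap, map_intCast]
  rw [hcoe] at hσ₁
  have hσ₁ne : ¬ σ₁ • geomSqrt (d : ℚ) = geomSqrt (d : ℚ) := by
    rw [hσ₁]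
    intro h
    exact geomSqrt_ne_zero hd0 (neg_eq_self.mp h)
  -- an inertia element whose cyclotomic character generates `𝔽_p^×`; its square
  obtain ⟨u, hu⟩ := IsCyclic.exists_generator (α := (ZMod p)ˣ)
  have hord : orderOf u = p - 1 := by
    rw [orderOf_eq_card_of_forall_mem_zpowers hu, Nat.card_eq_fintype_card, ZMod.card_units]
  obtain ⟨τ, hτI, hτu⟩ := exists_mem_inertia_modPCyclotomicCharacterZMod_eq p hpv h𝔓 u
  have hτ2I : τ * τ ∈ 𝔓.inertia (absoluteGaloisGroup ℚ) := Subgroup.mul_mem _ hτI hτI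
  have hτ2fix : (τ * τ) • geomSqrt (d : ℚ) = geomSqrt (d : ℚ) := by
    rcases smul_geomSqrt_eq_or τ (d : ℚ) with h | h
    · rw [mul_smul, h, h]
    · rw [mul_smul, h, smul_neg, h, neg_neg]
  have hu2 : u * u ≠ 1 := by
    intro h
    have h2 : orderOf u ∣ 2 := orderOf_dvd_of_pow_eq_one (by rw [pow_two]; exact h)
    rw [hord] at h2
    have := Nat.le_of_dvd two_pos h2
    omega
  have hχτ2 : modPCyclotomicCharacterZMod ℚ p (τ * τ) = u * u := by rw [map_mul, hτu]
  -- inertia acts on `L` through `χ̄_p`; so `τ²` moves every non-zero point of `L`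
  have hτ2L : ∀ T ∈ L, T ≠ 0 → (τ * τ) • T ≠ T := by
    intro T hT hT0 h
    rw [MixedCongruence.smul_eq_cyclotomic_zsmul_of_forall_sub_mem V p (τ * τ) hL (hLsub _ hτ2I) hT] at h
    have h1 := intCast_eq_one_of_zsmul_eq_self hT0 h
    rw [Int.cast_natCast, ZMod.natCast_zmod_val, hχτ2, Units.val_eq_one] at h1
    exact hu2 h1
  -- when `ΦV ≠ L`, inertia acts trivially on `ΦV`
  have htriv : ΦV ⊓ L = ⊥ → ∀ σ ∈ 𝔓.inertia (absoluteGaloisGroup ℚ), ∀ T ∈ ΦV, σ • T = T := by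
    intro hinf σ hσ T hT
    have h3 : σ • T - T ∈ ΦV ⊓ L := ⟨ΦV.sub_mem (hstab σ T hT) hT, hLsub σ hσ T⟩
    rw [hinf, AddSubgroup.mem_bot] at h3
    exact sub_eq_zero.mp h3
  -- a non-zero point of `Φ` and of `L`
  obtain ⟨P₀, hP₀Φ, hP₀⟩ := exists_mem_ne_zero_of_natCard_eq hΦ.1
  have hx₀ : e P₀ ≠ 0 := (AddEquiv.map_ne_zero_iff e).mpr hP₀
  have hx₀Φ : e P₀ ∈ ΦV := (hmem P₀).mpr hP₀Φ
  obtain ⟨y₀, hy₀L, hy₀⟩ := exists_mem_ne_zero_of_natCard_eq hL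
  refine ⟨fun hfix ↦ ?_, fun hquot ↦ ?_⟩
  · -- (1) `D_𝔓` does not fix `Φ` pointwise
    rcases line_eq_or_inf_eq_bot hΦVcard hL with heq | hinf
    · -- `e(Φ) = L`: `τ²` fixes `P₀`, hence `e P₀ ∈ L` — impossible
      have h1 : (τ * τ) • P₀ = P₀ := hfix _ (hID hτ2I) P₀ hP₀Φ
      have h2 : (τ * τ) • e P₀ = e P₀ := by rw [← hpos _ hτ2fix, h1]
      exact hτ2L (e P₀) (heq ▸ hx₀Φ) hx₀ h2
    · -- `e(Φ) ≠ L`: `σ₁` fixes `P₀` but acts by `−1` on `e P₀`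
      have h1 : σ₁ • P₀ = P₀ := hfix _ (hID hσ₁I) P₀ hP₀Φ
      have h2 : e P₀ = -(σ₁ • e P₀) := by rw [← hneg _ hσ₁ne, h1]
      have h3 : σ₁ • e P₀ = e P₀ := htriv hinf σ₁ hσ₁I _ hx₀Φ
      rw [h3] at h2
      exact hx₀ (eq_zero_of_neg_eq_self hp2 h2.symm)
  · -- (2) `D_𝔓` does not act trivially on `W[p]/Φ`
    have hquotV : ∀ g ∈ 𝔓.decompositionSubgroup (absoluteGaloisGroup ℚ), ∀ T : geomTorsion V (p : ℤ),
        e (g • e.symm T) - T ∈ ΦV := by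
      intro g hg T
      have h := hquot g hg (e.symm T)
      rw [← hmem, map_sub, e.apply_symm_apply] at h
      exact h
    rcases line_eq_or_inf_eq_bot hΦVcard hL with heq | hinf
    · -- `e(Φ) = L`: with `σ₁`, `−σ₁T − T ∈ L` and `σ₁T − T ∈ L`, so `2T ∈ L` for all `T`: `L = V[p]`
      obtain ⟨Q₀, hQ₀⟩ := exists_not_mem_of_natCard_eq hL
      apply hQ₀
      have h1 : e (σ₁ • e.symm Q₀) - Q₀ ∈ L := heq ▸ hquotV σ₁ (hID hσ₁I) Q₀
      rw [hneg _ hσ₁ne, e.apply_symm_apply] at h1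
      have h2 : σ₁ • Q₀ - Q₀ ∈ L := hLsub σ₁ hσ₁I Q₀
      have h3 : -(σ₁ • Q₀) - Q₀ + (σ₁ • Q₀ - Q₀) = -((2 : ℤ) • Q₀) := by
        rw [two_zsmul]; abel
      have h4 : -((2 : ℤ) • Q₀) ∈ L := h3 ▸ L.add_mem h1 h2
      exact mem_of_two_zsmul_mem hp2 ((neg_mem_iff).mp h4)
    · -- `e(Φ) ≠ L`: with `τ²`, `τ²T − T ∈ e(Φ) ∩ L = 0` for all `T`, so `τ²` is trivial on `L` — impossible
      have h1 : e ((τ * τ) • e.symm y₀) - y₀ ∈ ΦV := hquotV _ (hID hτ2I) y₀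
      rw [hpos _ hτ2fix, e.apply_symm_apply] at h1
      have h3 : (τ * τ) • y₀ - y₀ ∈ ΦV ⊓ L := ⟨h1, hLsub _ hτ2I y₀⟩
      rw [hinf, AddSubgroup.mem_bot] at h3
      exact hτ2L y₀ hy₀L hy₀ (sub_eq_zero.mp h3)

/-- **Transport of the clause to a conjugate prime.**  Both negations are invariant under `𝔓 ↦ σ • 𝔓`
(`D_{σ𝔓} = σ D_𝔓 σ⁻¹`) because `Φ` is `Γ_ℚ`-stable (the bookkeeping of `KellerYinLemma511NonsplitOfPrint` §1).
[cite: NeukirchANT1999, Ch. I §9 Prop. (9.1) and remark after (9.5)] -/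
theorem not_fix_and_not_quot_smul {Φ : AddSubgroup (geomTorsion W (p : ℤ))} (hΦ : IsRationalLine W p Φ)
    {𝔓₀ : Ideal (absIntegers (𝓞 ℚ) ℚ)} (σ : absoluteGaloisGroup ℚ)
    (h : (¬ ∀ g ∈ 𝔓₀.decompositionSubgroup (absoluteGaloisGroup ℚ), ∀ P ∈ Φ, g • P = P) ∧
      (¬ ∀ g ∈ 𝔓₀.decompositionSubgroup (absoluteGaloisGroup ℚ),
        ∀ P : geomTorsion W (p : ℤ), g • P - P ∈ Φ)) :
    (¬ ∀ g ∈ (σ • 𝔓₀).decompositionSubgroup (absoluteGaloisGroup ℚ), ∀ P ∈ Φ, g • P = P) ∧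
      (¬ ∀ g ∈ (σ • 𝔓₀).decompositionSubgroup (absoluteGaloisGroup ℚ),
        ∀ P : geomTorsion W (p : ℤ), g • P - P ∈ Φ) := by
  obtain ⟨h1, h2⟩ := h
  have hconj : ∀ g ∈ 𝔓₀.decompositionSubgroup (absoluteGaloisGroup ℚ),
      σ * g * σ⁻¹ ∈ (σ • 𝔓₀).decompositionSubgroup (absoluteGaloisGroup ℚ) := by
    intro g hg
    rw [Ideal.decompositionSubgroup_smul]
    have := Subgroup.smul_mem_pointwise_smul g (MulAut.conj σ) _ hg
    simpa only [MulAut.smul_def, MulAut.conj_apply] using this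
  refine ⟨fun h ↦ h1 fun g hg P hP ↦ ?_, fun h ↦ h2 fun g hg P ↦ ?_⟩
  · have hσP : σ • P ∈ Φ := hΦ.2 σ P hP
    have h' := h _ (hconj g hg) (σ • P) hσP
    rw [mul_smul, mul_smul, inv_smul_smul] at h'
    simpa only [inv_smul_smul] using congrArg (σ⁻¹ • ·) h'
  · have h' := h _ (hconj g hg) (σ • P)
    rw [mul_smul, mul_smul, inv_smul_smul, ← smul_sub] at h'
    simpa only [inv_smul_smul] using hΦ.2 σ⁻¹ _ h'

end Local

/-! ### §2 Class forms: the good-ordinary twist (every `𝔓 ∣ p`), the multiplicative twist, the two cells -/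

section Classes

/-- `p* = (−1)^{⌊p/2⌋} p` as a rational is the cast of the integer `p*`. [folklore] -/
theorem pStar_cast (p : ℕ) : (((-1 : ℤ) ^ (p / 2) * p : ℤ) : ℚ) = (-1 : ℚ) ^ (p / 2) * p := by push_cast; ring

variable {V W : WeierstrassCurve ℚ} [V.IsElliptic] [V.IsGloballyMinimal] (p : ℕ) [hp : Fact p.Prime]

/-- **(G-ord, `e = 2`) shape, every prime above `p`.**  `V/ℚ` globally minimal GOOD ORDINARY at `p ≥ 5`, `W = C • V^{(p*)}`:
for every `𝔓 ∣ p` and every rational line `Φ ≤ W[p]`, `D_𝔓` neither fixes `Φ` pointwise nor acts trivially on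
`W[p]/Φ` (§1 with Serre's unramified-quotient line of `V[p]`, `MixedCongruence.unramifiedQuotientLineAt_of_goodOrdinary`,
and `ord_p(p*) = 1`). [cite: Serre1972, §1.11 Prop. 11] [cite: SilvermanAEC2009, X.5 Cor. 5.4] -/
theorem not_fix_and_not_quot_of_goodOrd_pStar_twist (hp5 : 5 ≤ p) (hV : GoodOrd V p)
    (C : VariableChange ℚ) (hC : C • V.quadraticTwist ((-1 : ℚ) ^ (p / 2) * p) = W)
    {v : HeightOneSpectrum (𝓞 ℚ)} (hpv : ((p : ℕ) : 𝓞 ℚ) ∈ v.asIdeal)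
    {𝔓 : Ideal (absIntegers (𝓞 ℚ) ℚ)} (h𝔓 : 𝔓 ∈ v.primesAbove)
    {Φ : AddSubgroup (geomTorsion W (p : ℤ))} (hΦ : IsRationalLine W p Φ) :
    (¬ ∀ g ∈ 𝔓.decompositionSubgroup (absoluteGaloisGroup ℚ), ∀ P ∈ Φ, g • P = P) ∧
      (¬ ∀ g ∈ 𝔓.decompositionSubgroup (absoluteGaloisGroup ℚ),
        ∀ P : geomTorsion W (p : ℤ), g • P - P ∈ Φ) := by
  have hp2 : p ≠ 2 := by omega
  rw [← pStar_cast p] at hC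
  exact not_fix_and_not_quot_of_twist_of_unramifiedQuotientLine hp5 C hC hpv (intValuation_pStar p hpv) h𝔓
    (MixedCongruence.unramifiedQuotientLineAt_of_goodOrdinary hp2 hV.1 hV.2 hpv h𝔓) hΦ

/-- **(M) shape, every prime above `p`.**  `V/ℚ` globally minimal MULTIPLICATIVE at `p ≥ 5`, `W = C • V^{(p*)}`: for every
`𝔓 ∣ p` and every rational line `Φ ≤ W[p]`, `D_𝔓` neither fixes `Φ` pointwise nor acts trivially on `W[p]/Φ` (§1 with X2's
Tate line of `V[p]` at the chosen prime above `p` — PROVED Tate uniformisation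
`TateCurve.Silverman1994_thmV53_tateUniformisation_holds` / `…corV54…_holds` —, moved to every `𝔓` by conjugation).
[cite: SilvermanATAEC1994, Ch. V Thm. 5.3, Cor. 5.4] [cite: Serre1972, §1.12 Prop. 13] [cite: SilvermanAEC2009, X.5 Cor. 5.4] -/
theorem not_fix_and_not_quot_of_mult_pStar_twist (hp5 : 5 ≤ p) (hV : Mult V p)
    (C : VariableChange ℚ) (hC : C • V.quadraticTwist ((-1 : ℚ) ^ (p / 2) * p) = W)
    {v : HeightOneSpectrum (𝓞 ℚ)} (hpv : ((p : ℕ) : 𝓞 ℚ) ∈ v.asIdeal)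
    {𝔓 : Ideal (absIntegers (𝓞 ℚ) ℚ)} (h𝔓 : 𝔓 ∈ v.primesAbove)
    {Φ : AddSubgroup (geomTorsion W (p : ℤ))} (hΦ : IsRationalLine W p Φ) :
    (¬ ∀ g ∈ 𝔓.decompositionSubgroup (absoluteGaloisGroup ℚ), ∀ P ∈ Φ, g • P = P) ∧
      (¬ ∀ g ∈ 𝔓.decompositionSubgroup (absoluteGaloisGroup ℚ),
        ∀ P : geomTorsion W (p : ℤ), g • P - P ∈ Φ) := by
  have hpP : p.Prime := hp.out
  have hp2 : p ≠ 2 := by omega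
  rw [← pStar_cast p] at hC
  obtain ⟨v₀, hv₀, 𝔓₀, h𝔓₀, L, hL, hLsub, -⟩ :=
    X2.IsogenyLineType.exists_tateLine_adicCompletionPrime V p
      TateCurve.Silverman1994_thmV53_tateUniformisation_holds
      TateCurve.Silverman1994_thmV53_corV54_tateUniformisation_holds hp2 hV
  -- the unique place of `ℚ` above `p`
  have hvv : v₀ = v := HeightOneSpectrum.ext
    (by rw [Rat.asIdeal_eq_span_of_prime_mem v₀ hpP hv₀, Rat.asIdeal_eq_span_of_prime_mem v hpP hpv])
  subst hvv
  have h₀ := not_fix_and_not_quot_of_twist_of_unramifiedQuotientLine hp5 C hC hv₀ (intValuation_pStar p hv₀) h𝔓₀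
    ⟨L, hL, hLsub⟩ hΦ
  obtain ⟨σ, hσ⟩ := IsDedekindDomain.HeightOneSpectrum.exists_smul_eq_of_mem_primesAbove_holds h𝔓₀ h𝔓
  rw [← hσ]
  exact not_fix_and_not_quot_smul hΦ σ h₀

variable (W) [W.IsElliptic] [W.IsGloballyMinimal]

/-- **The (G-ord, `e = 2`) cell of B6 ∩ X3 at `p ≥ 5`: the non-anomalous clause holds at every `𝔓 ∣ p` for every rational
line.**  `ClassX3 W p ∧ SubGordTwo W p` is the class `X3♯(G-ord) ∩ I₀*` (`classX3Gord_iff_subGord`), which has the good-ordinary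
twist model `W = C • V^{(p*)}` (`ClassX3Gord.exists_goodOrd_pStar_twist_model`); then the good-ordinary shape above.
[cite: Serre1972, §1.11 Prop. 11] [cite: SilvermanAEC2009, X.5 Cor. 5.4] -/
theorem not_fix_and_not_quot_of_classX3_of_subGordTwo (hp5 : 5 ≤ p) (hX : ClassX3 W p) (hSG : SubGordTwo W p)
    {v : HeightOneSpectrum (𝓞 ℚ)} (hpv : ((p : ℕ) : 𝓞 ℚ) ∈ v.asIdeal)
    {𝔓 : Ideal (absIntegers (𝓞 ℚ) ℚ)} (h𝔓 : 𝔓 ∈ v.primesAbove)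
    {Φ : AddSubgroup (geomTorsion W (p : ℤ))} (hΦ : IsRationalLine W p Φ) :
    (¬ ∀ g ∈ 𝔓.decompositionSubgroup (absoluteGaloisGroup ℚ), ∀ P ∈ Φ, g • P = P) ∧
      (¬ ∀ g ∈ 𝔓.decompositionSubgroup (absoluteGaloisGroup ℚ),
        ∀ P : geomTorsion W (p : ℤ), g • P - P ∈ Φ) := by
  have hp2 : p ≠ 2 := by omega
  have hXG : ClassX3Gord W p := (classX3Gord_iff_subGord W p hp2 hX).mpr hSG.1
  obtain ⟨V, _, _, C, hV, hC⟩ := ClassX3Gord.exists_goodOrd_pStar_twist_model W p hp2 hXG hSG.2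
  exact not_fix_and_not_quot_of_goodOrd_pStar_twist p hp5 hV C hC hpv h𝔓 hΦ

omit [W.IsGloballyMinimal] in
/-- **The (M) cell of B6 ∩ X3 at `p ≥ 5`: the non-anomalous clause holds at every `𝔓 ∣ p` for every rational line.**
`ClassX3 W p ∧ SubM W p` gives the multiplicative twist model `W = C • V^{(p*)}`
(`AdditivePotMult.PotMult.exists_mult_pStar_twist_model`); then the multiplicative shape above (Tate uniformisation PROVED).
[cite: SilvermanATAEC1994, Ch. V Thm. 5.3, Cor. 5.4] [cite: SilvermanAEC2009, X.5 Cor. 5.4] -/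
theorem not_fix_and_not_quot_of_classX3_of_subM (hp5 : 5 ≤ p) (hX : ClassX3 W p) (hSM : SubM W p)
    {v : HeightOneSpectrum (𝓞 ℚ)} (hpv : ((p : ℕ) : 𝓞 ℚ) ∈ v.asIdeal)
    {𝔓 : Ideal (absIntegers (𝓞 ℚ) ℚ)} (h𝔓 : 𝔓 ∈ v.primesAbove)
    {Φ : AddSubgroup (geomTorsion W (p : ℤ))} (hΦ : IsRationalLine W p Φ) :
    (¬ ∀ g ∈ 𝔓.decompositionSubgroup (absoluteGaloisGroup ℚ), ∀ P ∈ Φ, g • P = P) ∧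
      (¬ ∀ g ∈ 𝔓.decompositionSubgroup (absoluteGaloisGroup ℚ),
        ∀ P : geomTorsion W (p : ℤ), g • P - P ∈ Φ) := by
  have hp2 : p ≠ 2 := by omega
  have hpm : AdditivePotMult.PotMult W p := ⟨hX.2, hSM⟩
  obtain ⟨V, _, _, C, hV, hC⟩ := hpm.exists_mult_pStar_twist_model hp2
  exact not_fix_and_not_quot_of_mult_pStar_twist p hp5 hV C hC hpv h𝔓 hΦ

/-- **The semistable-twist cells of B6 ∩ X3 at `p ≥ 5`** (`SubSemistableTwist = SubM ∨ SubGordTwo`): the non-anomalous clause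
at every `𝔓 ∣ p` for every rational line. [cite: Serre1972, §1.11 Prop. 11 and §1.12 Prop. 13] [cite: SilvermanAEC2009, X.5 Cor. 5.4] -/
theorem not_fix_and_not_quot_of_classX3_of_subSemistableTwist (hp5 : 5 ≤ p) (hX : ClassX3 W p)
    (hS : SubSemistableTwist W p)
    {v : HeightOneSpectrum (𝓞 ℚ)} (hpv : ((p : ℕ) : 𝓞 ℚ) ∈ v.asIdeal)
    {𝔓 : Ideal (absIntegers (𝓞 ℚ) ℚ)} (h𝔓 : 𝔓 ∈ v.primesAbove)
    {Φ : AddSubgroup (geomTorsion W (p : ℤ))} (hΦ : IsRationalLine W p Φ) :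
    (¬ ∀ g ∈ 𝔓.decompositionSubgroup (absoluteGaloisGroup ℚ), ∀ P ∈ Φ, g • P = P) ∧
      (¬ ∀ g ∈ 𝔓.decompositionSubgroup (absoluteGaloisGroup ℚ),
        ∀ P : geomTorsion W (p : ℤ), g • P - P ∈ Φ) :=
  hS.elim (fun h ↦ not_fix_and_not_quot_of_classX3_of_subM W p hp5 hX h hpv h𝔓 hΦ)
    (fun h ↦ not_fix_and_not_quot_of_classX3_of_subGordTwo W p hp5 hX h hpv h𝔓 hΦ)

end Classes

end Summit.BirchSwinnertonDyer.BirchSwinnertonDyer.Theorems.SchneiderFreeAdditiveX3.SemistableTwistLocal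

end
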